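/-
Copyright: the b2b-balaban cell (near-miss cell 7), T⁴-continuum fan-out; row NE7b ROUND-2 swarm, seat
t4-ne7b-formalise-leaf-05 gen 3 (row S6g′ INSTANCE of `t4/b2b-balaban-t4-ne7b-p1/LEAVES-NE7b.md`, owner's ruling
R-OWNER-22-20 (2)).  Released under the licence of the surrounding project.
-/
import Summits.QuantumFields.BalabanUV.T4Continuum.Support.HistoryRenewalsCost

/-!
# The renewal count is class-linear, cost side — ON THE FLAT TREE the binder counts on (row S6g′, «INST-NR» part 2)

Summits-side support leaf of the T⁴-continuum cell (rung (B)+1 on a FINITE torus only; NOT infinite volume, NOT the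
mass gap, NOT the Clay statement; NOT a proof of the spine estimate NE7b).  Row NE7b, route «COUNT», row S6g′; sequel
of `HistoryRenewalsCost`.  [folklore] structural recursion over the lineage's own carrier; nothing is quoted from
print, nothing printed is asserted, no `[cite:]` tag, no `Prop` fact minted, no definition.

WHY.  The binding (`HistoryJoinsEnd.card_S_le_exp_pow`) counts on the CLASS REPRESENTATIVE — the flat shape tree
`relabel f G′` (`P.gen c = gmap Prod.fst (P.genT c)`), whose `events` FINSET merges equal labels — so the booked cost
`totalCostT` (a sum over the events finset) must be read on the FRESH TAGGED member `G′`, while `NR` ∕ `ENT` are read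
on the flat tree.  The structural count `nrenew` is the same on both (`nrenew_relabel`), which transports part 1's
`nrenew·φ ≤ totalCostT` across the relabelling.

WHAT.  `nrenew_relabel`, `nrenew_gmap`; **`NR_relabel_le_totalCostT_div`**; the END **`ENT_leRC_relabel`**
(`G = relabel f G′`, `st′ ∘ f = st`, `G′` fresh + `ConsistentTLE`, displays `Mono st G′` and `InjPartsR st′ fat′ G`):
`ENT st′ G ≤ 2·bsum (1 + fat′) G + 4·partnerAges st′ G + 8·mrg st′ G + (8 ∕ φ)·totalCostT sh C K R G′`; on pedigrees'
FLAT genealogies (`st := PEv.step ∘ id`, leaf-02 gen 3's `HistoryZoneMassTotalFlat` convention): **`ENT_leRC_gen`**,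
`ENT_leRC_gen_E₂`, `NR_gen_le` — from `HeadOldest`, `Forest`, the tagged member's `ConsistentTLE Prod.fst C K R
(P.genT c)` BY NAME (H1b) and the flat display `InjPartsR` (row S1c: canonical order ⇒ by construction).

HONEST SCOPE.  As part 1: displays with named suppliers; the constant check `exp((8∕φ)·T)` vs the LE exit's margin is
the instance END's.  Nothing of H3∕(B)∕BetaPertH touched; `BirthShapeNodup` NOT retired here; NE7b NOT proved.
HONEST DEPENDENCY (cell): continuum YM on T⁴ ⇐ BetaPertH ∧ nine spine estimates (0/9 proved); BetaPertH ⇐ (D1) ∧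
(D4) ∧ CAP+tail; G-an2-4 gates asym, D1 and NE2/3/4.  This file changes none of it.
-/

open Finset
open Literature.MathematicalPhysics.QuantumFieldTheory.Balaban1983to89
open T4PersistenceDictionary T4PrintedShapeBanking T4TaggedShapeBanking T4PartnerMultiplicity T4BranchingRecordsGas
open Summit.QuantumFields.BalabanUV.T4Continuum.LateMergers
open Summit.QuantumFields.BalabanUV.T4Continuum.HistoryBankingLE
open Summit.QuantumFields.BalabanUV.T4Continuum.HistoryJoins
open Summit.QuantumFields.BalabanUV.T4Continuum.HistoryJoinsAdm
open Summit.QuantumFields.BalabanUV.T4Continuum.HistorySiblingEntropyBridge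
open Summit.QuantumFields.BalabanUV.T4Continuum.HistoryJoinsBudget (mrg)
open Summit.QuantumFields.BalabanUV.T4Continuum.HistoryJoinsEntropyBudget (ENT)
open Summit.QuantumFields.BalabanUV.T4Continuum.HistoryRenewalsCost

namespace Summit.QuantumFields.BalabanUV.T4Continuum.HistoryRenewalsCost

noncomputable section

variable {ε : Type*}

/-! ## §1 The count is relabelling-invariant; the cost is the tagged member's -/

section Relabel

variable {δ : Type*}

/-- **THE RENEWAL COUNT IS RELABELLING-INVARIANT** (same tree). [folklore] -/
@[simp] theorem nrenew_relabel (f : ε → δ) : ∀ G : Gen ε, nrenew (relabel f G) = nrenew G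
  | Gen.born _ _ => rfl
  | Gen.renew G e h => by rw [relabel_renew, nrenew_renew, nrenew_renew, nrenew_relabel f G]
  | Gen.merge X Y e => by rw [relabel_merge, nrenew_merge, nrenew_merge, nrenew_relabel f X, nrenew_relabel f Y]

/-- the same for the zone chain's `gmap` [folklore] -/
@[simp] theorem nrenew_gmap (f : ε → δ) (G : Gen ε) : nrenew (ZoneSkeleton.gmap f G) = nrenew G := by
  rw [← HistoryGen.Pedigree.relabel_eq_gmap' f G, nrenew_relabel]

variable [DecidableEq ε] {sh : ε → PEv} {C : T4PrintedShapeBanking.Consts} {K : ℕ} {R : ℕ → ℕ}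

/-- **`NR` OF THE FLAT TREE ≤ THE TAGGED MEMBER'S BOOKED COST ∕ φ**: for `G = relabel f G′` with `G′` fresh and
`ConsistentTLE`, floors `≥ φ > 0` on the run. [folklore] -/
theorem NR_relabel_le_totalCostT_div (f : ε → δ) (st' : δ → ℕ) (hE₂ : 0 ≤ C.E₂) (hE₃ : 0 ≤ C.E₃) {φ : ℝ}
    (hφ0 : 0 < φ) (hφ : ∀ n, n ≤ K → φ ≤ floorK C K R n) {G' : Gen ε} (hf : FreshT G')
    (hc : ConsistentTLE sh C K R G') : (NR st' (relabel f G') : ℝ) ≤ totalCostT sh C K R G' / φ := by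
  rw [NR_cast_eq_nrenew, nrenew_relabel, le_div_iff₀ hφ0]
  exact nrenew_mul_le_totalCostT hE₂ hE₃ hφ0.le hφ hf hc

/-- **THE END ON THE FLAT TREE OF A FRESH TAGGED MEMBER**: `G = relabel f G′`, `f` step-preserving
(`st′ ∘ f = st`), `G′` fresh and `ConsistentTLE`; displays `Mono st G′` (free on pedigrees) and `InjPartsR st′ fat′ G`
(canonical order ∕ labels of the FLAT tree, row S1c); floors `≥ φ > 0` on the run:
`ENT st′ G ≤ 2·bsum (1 + fat′) G + 4·partnerAges st′ G + 8·mrg st′ G + (8 ∕ φ)·totalCostT sh C K R G′`. [folklore] -/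
theorem ENT_leRC_relabel (f : ε → δ) {st : ε → ℕ} {st' : δ → ℕ} (hst : ∀ e, st' (f e) = st e) (fat' : δ → ℕ)
    (hE₂ : 0 ≤ C.E₂) (hE₃ : 0 ≤ C.E₃) {φ : ℝ} (hφ0 : 0 < φ) (hφ : ∀ n, n ≤ K → φ ≤ floorK C K R n)
    {G' : Gen ε} (hm : Mono st G') (hi : InjPartsR st' fat' (relabel f G')) (hf : FreshT G')
    (hc : ConsistentTLE sh C K R G') :
    ENT st' (relabel f G') ≤ 2 * bsum (fun b => (1 : ℝ) + fat' b) (relabel f G') +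
      4 * (partnerAges st' (relabel f G') : ℝ) + 8 * mrg st' (relabel f G') + 8 / φ * totalCostT sh C K R G' := by
  have h := ENT_leR st' fat' (relabel f G') (mono_relabel f hst hm) hi
  have hNR := NR_relabel_le_totalCostT_div f st' hE₂ hE₃ hφ0 hφ hf hc
  have : 8 * (NR st' (relabel f G') : ℝ) ≤ 8 / φ * totalCostT sh C K R G' := by
    rw [div_mul_eq_mul_div, le_div_iff₀ hφ0]
    have := mul_le_mul_of_nonneg_left hNR (by norm_num : (0 : ℝ) ≤ 8)
    rw [mul_div_assoc'] at this
    exact (le_div_iff₀ hφ0).1 this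
  linarith

end Relabel

/-! ## §2 On the flat genealogy of a pedigree -/

section FlatPedigree

open HistoryGen

variable {α π : Type*} [DecidableEq α] [DecidableEq π] (P : HistoryGen.Pedigree α π)

/-- **ON THE FLAT GENEALOGY `P.gen c` OF A PEDIGREE** (the tree the binder counts on; `st := PEv.step ∘ id` as in
leaf-02 gen 3's `HistoryZoneMassTotalFlat`): `HeadOldest`, `Forest`, the tagged member's `ConsistentTLE` (H1b, by
name), the flat order ∕ label display `InjPartsR`, floors `≥ φ > 0`; the cost is the TAGGED member's `totalCostT`.
[folklore] -/
theorem ENT_leRC_gen (hH : ∀ c, P.HeadOldest c) (hF : ∀ c, P.Forest c) (fat : PEv → ℕ)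
    {C : T4PrintedShapeBanking.Consts} {K : ℕ} {R : ℕ → ℕ} (hE₂ : 0 ≤ C.E₂) (hE₃ : 0 ≤ C.E₃) {φ : ℝ}
    (hφ0 : 0 < φ) (hφ : ∀ n, n ≤ K → φ ≤ floorK C K R n) (c : α)
    (hi : InjPartsR (PEv.step ∘ (id : PEv → PEv)) fat (P.gen c)) (hc : ConsistentTLE Prod.fst C K R (P.genT c)) :
    ENT (PEv.step ∘ (id : PEv → PEv)) (P.gen c) ≤
      2 * bsum (fun b => (1 : ℝ) + fat b) (P.gen c) +
        4 * (partnerAges (PEv.step ∘ (id : PEv → PEv)) (P.gen c) : ℝ) +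
        8 * mrg (PEv.step ∘ (id : PEv → PEv)) (P.gen c) + 8 / φ * totalCostT Prod.fst C K R (P.genT c) := by
  have hg : P.gen c = relabel Prod.fst (P.genT c) := (HistoryGen.Pedigree.relabel_eq_gmap' Prod.fst (P.genT c)).symm
  rw [hg] at hi ⊢
  exact ENT_leRC_relabel Prod.fst (st := PEv.step ∘ Prod.fst) (fun _ => rfl) fat hE₂ hE₃ hφ0 hφ (mono_genT P hH c) hi
    (Pedigree.freshT_genT hF c) hc

/-- **READING 1 on the flat genealogy** (`R ≥ 1` on the run, `E₂ > 0`). [folklore] -/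
theorem ENT_leRC_gen_E₂ (hH : ∀ c, P.HeadOldest c) (hF : ∀ c, P.Forest c) (fat : PEv → ℕ)
    {C : T4PrintedShapeBanking.Consts} {K : ℕ} {R : ℕ → ℕ} (hE₂ : 0 < C.E₂) (hE₃ : 0 ≤ C.E₃)
    (hR1 : ∀ n, n ≤ K → 1 ≤ R n) (c : α)
    (hi : InjPartsR (PEv.step ∘ (id : PEv → PEv)) fat (P.gen c)) (hc : ConsistentTLE Prod.fst C K R (P.genT c)) :
    ENT (PEv.step ∘ (id : PEv → PEv)) (P.gen c) ≤
      2 * bsum (fun b => (1 : ℝ) + fat b) (P.gen c) +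
        4 * (partnerAges (PEv.step ∘ (id : PEv → PEv)) (P.gen c) : ℝ) +
        8 * mrg (PEv.step ∘ (id : PEv → PEv)) (P.gen c) + 8 / C.E₂ * totalCostT Prod.fst C K R (P.genT c) :=
  ENT_leRC_gen P hH hF fat hE₂.le hE₃ hE₂ (fun n hn => E₂_le_floorK (C := C) hE₂.le hn (hR1 n hn)) c
    hi hc

/-- the flat tree's renewal count against the tagged member's booked cost (no entropy display). [folklore] -/
theorem NR_gen_le (hF : ∀ c, P.Forest c) {C : T4PrintedShapeBanking.Consts} {K : ℕ} {R : ℕ → ℕ}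
    (hE₂ : 0 ≤ C.E₂) (hE₃ : 0 ≤ C.E₃) {φ : ℝ} (hφ0 : 0 < φ) (hφ : ∀ n, n ≤ K → φ ≤ floorK C K R n) (c : α)
    (hc : ConsistentTLE Prod.fst C K R (P.genT c)) :
    (NR (PEv.step ∘ (id : PEv → PEv)) (P.gen c) : ℝ) ≤ totalCostT Prod.fst C K R (P.genT c) / φ := by
  have hg : P.gen c = relabel Prod.fst (P.genT c) := (HistoryGen.Pedigree.relabel_eq_gmap' Prod.fst (P.genT c)).symm
  rw [hg]
  exact NR_relabel_le_totalCostT_div Prod.fst _ hE₂ hE₃ hφ0 hφ (Pedigree.freshT_genT hF c) hc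

end FlatPedigree

end

end Summit.QuantumFields.BalabanUV.T4Continuum.HistoryRenewalsCost
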